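import Summits.QuantumFields.BalabanUV.Beta.GAN24.MixedChannelBondSums
import Summits.QuantumFields.BalabanUV.Beta.GAN24.TwoFaceWordAdditive
import Summits.QuantumFields.BalabanUV.Beta.GAN24.DressedMultiplierVertexZero
import Summits.QuantumFields.BalabanUV.Beta.GAN24.EEWordReduced

/-!
# `BalabanUV.Beta.GAN24.WWordMixedBondZero` — binder row G-an2-4 ∕ (CONV-C), W-slot CT-W, conservation law (C)∕(C)sym, step (L3b) of this lineage's note
# `HOME/b2b-balaban-gan24-formalise-leaf-04/g66/CSYM-LEVEL0-KERNEL-BLUEPRINT.md` §7: **THE MIXED BI-VERTICES DROP OUT OF THE LATTICE-BOND SUM OF THE FACE-WEIGHTED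
# `K·W·K` WORD OF THE DRESSED ONE-STEP SOURCE** — the two-face (face-weighted) pair sum of `W2SymOfK X̃♮_j Lc S M 0 M₂ κ u κ′ u′`, summed along the lattice
# bond `u′`, is half the bond sum of the two second-response words `dM (K2OfK X̃♮_j Lc S M κ′ u′) Lc S M κ u` and `dM (K2OfK X̃♮_j Lc S M κ u) Lc S M κ′ u′`

NOT IN PRINT; OUR BOOKKEEPING ([folklore]: leaf-14's generic `MixedChannelBondSums` (`hasSum_tsum_prod_of_bondNull`, `hasSum_firstBond_of_secondBond`,
`hasSum_tsum_prod_W2SymOfK_sub_resp` — the UNWEIGHTED double-leg sums through a block-covariant kernel) re-run with two bounded, block-periodic leg weights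
`ρ₁ ρ₂` inserted, over the same TREE objects BY NAME: leaf-13's `MultiplierMixedBondSum.hasSum_mixOfK_bond` ((S2c) pointwise), leaf-14's
`MixedChannelZeroMode.biLoc_mixOfK_far`, an2's `SecondOrderResponse` (`mixOfK_translate`, `vertexFamily₂_mixOfK`, `vertexFamily_K2OfK`, `vertexFamily₂_resp`, `W2OfK_apply`,
`W2SymOfK`), leaf-04's `T2RecursionAffine.vertex2OfK_zero`, this lineage's `ExchangeSlotResum.tsum_twoFace_shiftK` and `TwoFaceWordAdditive.summable_twoFace_of_biLoc`; the
dressed instances by `AxialDressingRooted.decays_coDressKBmAt`, `EEWordReduced.shiftK_dressedStep`, `DressedMultiplierVertexZero.hasSum_colM_dressedStep`; G-an2-4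
formalisation swarm, leaf prover `b2b-balaban-gan24-formalise-leaf-04`, gen 66).  HONEST FRAMING (cell contract, verbatim): «discharging `BetaPertH` makes Bałaban's UV
stability UNCONDITIONAL — a real constructive-QFT result; it is NOT the continuum limit and NOT the Clay problem.»  HONEST DEPENDENCY (verbatim): «continuum YM on T⁴ ⇐
BetaPertH ∧ nine spine estimates (0/9 proved); BetaPertH ⇐ (D1) ∧ (D4) ∧ CAP+tail; G-an2-4 gates asym, D1 and NE2/3/4.»

WHY.  By `DressedSourceZeroModeWords.zmode_dressedSource_inl_inl` the ff zero mode of the dressed one-step source `b̃_j` is `c·(−(s_f s_m σ_j)²Lc²)·Σ_{u∈box}Σ'_{u′}` of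
`FF[direct] + FF[swap] − FF[W̃♮_j κ u κ′ u′]`, `FF[K] = Σ'_{(y,w)} 𝟙f(y_α)𝟙f(w_β)·K y w (inl α)(inl β)`; the two exchange words are `DressedSourceExchangeWords`' numbers.  The
remaining word carries `W̃♮_j = W2SymOfK X̃♮_j Lc S♮_j M♮_j 0 M₂♮_j = ½(1 + swap)(vertex2OfK 0 + mixOfK + mixOfKˢʷᵃᵖ + dM (K2OfK …) …)` (`W2OfK_apply`); here the bi-vertex of
the zero table vanishes and BOTH mixed bi-vertices have zero lattice-bond sum of their face-weighted pair sums — the multiplier column of `X̃♮_j` has zero bond masses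
((S2c) for the dressed kernel, `hasSum_colM_dressedStep`) and kills the inner multiplier slot pointwise (`hasSum_mixOfK_bond`), the family is centre-tied
(`biLoc_mixOfK_far`) so the pair sums inherit the zero (`hasSum_tsum_prod_of_bondNull` on the WEIGHTED kernel), and the exchanged orientation follows by transposition of a
jointly translation-invariant double sequence (block covariance of `X̃♮_j` and of `M₂`, `Lc`-periodic weights).  What is left of `Σ'_{u′} FF[W̃♮_j κ u κ′ u′]` is half the
bond sum of the two SECOND-RESPONSE words.

WHAT ([folklore]; generic `d`; 0 `def`, 0 cited facts, 0 `def … : Prop`, 0 sorry; weights `|ρ₁|, |ρ₂| ≤ 1`, `N`-periodic where transposition is used; fibre legs `f g`):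
§1 GENERIC block `N`, kernel `K` with `Decays K C m`, zero `colM` bond masses, `LocStencilFM N M₂ C₂ m`: `biLoc_twoFace_weight`; **`hasSum_twoFace_mixOfK_bond`**
(`HasSum (u′ ↦ Σ'_{(y,w)} ρ₁(y)ρ₂(w)·mixOfK K N M₂ κ u κ′ u′ y w f g) 0`); `twoFace_mixOfK_translate`; **`hasSum_twoFace_mixOfK_swap_bond`** (first-bond orientation, `K`
block-covariant, `M₂` jointly block-covariant); **`hasSum_twoFace_W2SymOfK_sub_resp`** (`HasSum (u′ ↦ FFρ[W2SymOfK K N S M 0 M₂ κ u κ′ u′] − ½(FFρ[dM (K2OfK K N S M κ′ u′) N S M κ u]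
+ FFρ[dM (K2OfK K N S M κ u) N S M κ′ u′])) 0`, `S` `LocStencil`, `M` `VertexFamily`); `tsum_twoFace_W2SymOfK_eq_half_resp` (the `tsum` identity when the two response words are
summable along the bond).  §2 THE DRESSED INSTANCES at `X̃♮_j = unitK s_f s_m (coDressKBmAt ρ Lc (KInvStep Lc j))` (in-block root, `1 ≤ Lc`, every `j`, all units, ANY
`LocStencil` `S`, `VertexFamily` `M`, jointly covariant `LocStencilFM` `M₂` at positive rates): **`hasSum_twoFace_mixOfK_dressedStep_bond`**,
**`hasSum_twoFace_mixOfK_swap_dressedStep_bond`**, **`hasSum_twoFace_W2SymOfK_sub_resp_dressedStep`**, **`tsum_twoFace_W2SymOfK_dressedStep_eq_half_resp`**.  Asserts NO value of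
Bałaban's tables; discharges NOTHING of (C)sym ∕ (Q-D) ∕ (Q-D-rate) ∕ «T2Shape» ∕ «T2Drift» ∕ (hW, hWall); NEVER «G-an2-4 closed» as (CONV-C); NOT D1, NOT `BetaPertH`, NOT
continuum, NOT Clay.  2026-08-23; no existing file touched.
-/

noncomputable section

open Finset
open scoped BigOperators
open Literature.MathematicalPhysics.QuantumFieldTheory
open Literature.MathematicalPhysics.QuantumFieldTheory.Balaban1983to89
open Literature.MathematicalPhysics.QuantumFieldTheory.Balaban1983to89.Beta
open AffineAveraging (Site box toSite)
open B12Sec2to5 (l1 l1_nonneg)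
open ExpKernelCalculus (MKer Decays BiLoc VertexFamily shiftK l1_sub_symm)
open OneStepResolventKernel (Fib LocStencil biLoc_mono decays_mono)
open OneStepKernelFamily (KInvStep decays_KInvStep)
open BalabanStepJets (locStencil_mono)
open SecondOrderResponse (colM dM K2OfK vertex2OfK mixOfK W2OfK W2SymOfK W2OfK_apply LocStencilFM cBi vertexFamily₂_mixOfK vertexFamily_K2OfK vertexFamily₂_resp
  mixOfK_translate)
open Summit.QuantumFields.BalabanUV.Beta.HessKerDressedUnits (unitK decays_unitK)
open Summit.QuantumFields.BalabanUV.Beta.AxialDressingRooted (coDressKBmAt decays_coDressKBmAt)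
open Summit.QuantumFields.BalabanUV.Beta.GAN24.MultiplierMixedBondSum (hasSum_mixOfK_bond)
open Summit.QuantumFields.BalabanUV.Beta.GAN24.MixedChannelZeroMode (biLoc_mixOfK_far)
open Summit.QuantumFields.BalabanUV.Beta.GAN24.MixedChannelBondSums (hasSum_tsum_prod_of_bondNull hasSum_firstBond_of_secondBond)
open Summit.QuantumFields.BalabanUV.Beta.GAN24.T2RecursionAffine (vertex2OfK_zero)
open Summit.QuantumFields.BalabanUV.Beta.GAN24.ExchangeSlotResum (tsum_twoFace_shiftK)
open Summit.QuantumFields.BalabanUV.Beta.GAN24.TwoFaceWordAdditive (summable_twoFace_of_biLoc)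
open Summit.QuantumFields.BalabanUV.Beta.GAN24.EEWordReduced (shiftK_dressedStep)
open Summit.QuantumFields.BalabanUV.Beta.GAN24.DressedMultiplierVertexZero (hasSum_colM_dressedStep)

namespace Summit.QuantumFields.BalabanUV.Beta.GAN24.WWordMixedBondZero

variable {d : ℕ}

/-! ## §1 Generic block: the weighted bond-null argument for the mixed bi-vertex and the `W`-word reduction -/

section Generic

variable {N : ℕ} [NeZero N] {ρ₁ ρ₂ : Site (d + 1) → ℝ} {K : MKer (d + 1) (Fib d)} {C m : ℝ}
  {M₂ : Fin (d + 1) → Site (d + 1) → Fin (d + 1) → Site (d + 1) → MKer (d + 1) (Fib d)} {C₂ : ℝ}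
  {S M : Fin (d + 1) → Site (d + 1) → MKer (d + 1) (Fib d)} {Cs CM : ℝ}

omit [NeZero N] in
/-- [folklore] **BOUNDED LEG WEIGHTS PRESERVE BI-LOCALISATION**: `(y, w) ↦ ρ₁(y)ρ₂(w)·V y w` is `BiLoc` with the same data when `|ρ₁|, |ρ₂| ≤ 1`. -/
theorem biLoc_twoFace_weight {V : MKer (d + 1) (Fib d)} {p q : Site (d + 1)} {Cv δ : ℝ} (hV : BiLoc V p q Cv δ)
    (h₁ : ∀ y, |ρ₁ y| ≤ 1) (h₂ : ∀ w, |ρ₂ w| ≤ 1) :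
    BiLoc (fun y w a b => ρ₁ y * ρ₂ w * V y w a b) p q Cv δ := by
  intro y w a b
  have h := hV y w a b
  have h0 : 0 ≤ Cv * Real.exp (-δ * (l1 (y - p) + l1 (w - q))) := (abs_nonneg _).trans h
  show |ρ₁ y * ρ₂ w * V y w a b| ≤ Cv * Real.exp (-δ * (l1 (y - p) + l1 (w - q)))
  rw [abs_mul, abs_mul]
  calc |ρ₁ y| * |ρ₂ w| * |V y w a b| ≤ 1 * 1 * (Cv * Real.exp (-δ * (l1 (y - p) + l1 (w - q)))) :=
      mul_le_mul (mul_le_mul (h₁ y) (h₂ w) (abs_nonneg _) zero_le_one) h (abs_nonneg _) (by positivity)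
    _ = _ := by ring

/-- [folklore] **(S2c) ⟹ THE FACE-WEIGHTED PAIR SUMS OF THE MIXED BI-VERTEX HAVE ZERO BOND SUM (second-bond orientation)**: for `K` with `Decays K C m` (`m > 0`)
and zero `colM` bond masses, a `LocStencilFM` mixed table (rate `m`) and bounded weights,
`HasSum (u′ ↦ Σ'_{(y,w)} ρ₁(y)ρ₂(w)·mixOfK K N M₂ κ u κ′ u′ y w f g) 0` at every first bond `(κ, u)` and every fibre pair. -/
theorem hasSum_twoFace_mixOfK_bond (hK : Decays K C m) (hm : 0 < m)
    (hK0 : ∀ μ ρ w, HasSum (fun y : Site (d + 1) => colM K N μ y ρ w) 0) (hM₂ : LocStencilFM N M₂ C₂ m)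
    (h₁ : ∀ y, |ρ₁ y| ≤ 1) (h₂ : ∀ w, |ρ₂ w| ≤ 1)
    (κ : Fin (d + 1)) (u : Site (d + 1)) (κ' : Fin (d + 1)) (f g : Fib d) :
    HasSum (fun u' : Site (d + 1) => ∑' yw : Site (d + 1) × Site (d + 1), ρ₁ yw.1 * ρ₂ yw.2 * mixOfK K N M₂ κ u κ' u' yw.1 yw.2 f g) 0 := by
  have hC : 0 ≤ C := hK.nonneg (Sum.inl 0)
  have hm8 : 0 < m / 8 := by positivity
  have hVb : ∀ u' : Site (d + 1), BiLoc (fun y w a b => ρ₁ y * ρ₂ w * mixOfK K N M₂ κ u κ' u' y w a b) ((N : ℤ) • u) ((N : ℤ) • u)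
      (cBi d C C₂ m * Real.exp (-(m / 8) * l1 ((N : ℤ) • u' - (N : ℤ) • u))) (m / 8) := by
    intro u'
    have h := biLoc_mixOfK_far hK hC hM₂ hm κ u κ' u'
    rw [l1_sub_symm] at h
    exact biLoc_twoFace_weight h h₁ h₂
  have hV0 : ∀ (y w : Site (d + 1)) (f' g' : Fib d),
      HasSum (fun u' : Site (d + 1) => ρ₁ y * ρ₂ w * mixOfK K N M₂ κ u κ' u' y w f' g') 0 := by
    intro y w f' g'
    have h := (hasSum_mixOfK_bond hK hm hK0 hM₂ hm κ u κ' y w f' g').mul_left (ρ₁ y * ρ₂ w)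
    rwa [mul_zero] at h
  exact hasSum_tsum_prod_of_bondNull (V := fun u' => fun y w a b => ρ₁ y * ρ₂ w * mixOfK K N M₂ κ u κ' u' y w a b) hm8 hVb hV0 f g

/-- [folklore] **JOINT TRANSLATION INVARIANCE OF THE WEIGHTED MIXED PAIR SUMS** (block-covariant `K`, jointly block-covariant `M₂`, `N`-periodic weights). -/
theorem twoFace_mixOfK_translate (hKs : ∀ t, shiftK (-((N : ℤ) • t)) K = K)
    (hM₂t : ∀ (κ : Fin (d + 1)) (u : Site (d + 1)) (ρ : Fin (d + 1)) (w t : Site (d + 1)),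
      M₂ κ (u + (N : ℤ) • t) ρ (w + t) = shiftK (-((N : ℤ) • t)) (M₂ κ u ρ w))
    (hρ₁ : ∀ y s : Site (d + 1), ρ₁ (y + (N : ℤ) • s) = ρ₁ y) (hρ₂ : ∀ w s : Site (d + 1), ρ₂ (w + (N : ℤ) • s) = ρ₂ w)
    (κ : Fin (d + 1)) (u : Site (d + 1)) (κ' : Fin (d + 1)) (u' t : Site (d + 1)) (f g : Fib d) :
    (∑' yw : Site (d + 1) × Site (d + 1), ρ₁ yw.1 * ρ₂ yw.2 * mixOfK K N M₂ κ (u + t) κ' (u' + t) yw.1 yw.2 f g)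
      = ∑' yw : Site (d + 1) × Site (d + 1), ρ₁ yw.1 * ρ₂ yw.2 * mixOfK K N M₂ κ u κ' u' yw.1 yw.2 f g := by
  rw [mixOfK_translate hKs hM₂t κ u κ' u' t]
  exact tsum_twoFace_shiftK hρ₁ hρ₂ _ t f g

/-- [folklore] **(S2c) ⟹ ZERO BOND SUM OF THE WEIGHTED PAIR SUMS OF THE EXCHANGED MIXED BI-VERTEX (first-bond orientation)**, by transposition of the jointly
translation-invariant double sequence (`hasSum_firstBond_of_secondBond`). -/
theorem hasSum_twoFace_mixOfK_swap_bond (hK : Decays K C m) (hm : 0 < m) (hKs : ∀ t, shiftK (-((N : ℤ) • t)) K = K)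
    (hK0 : ∀ μ ρ w, HasSum (fun y : Site (d + 1) => colM K N μ y ρ w) 0) (hM₂ : LocStencilFM N M₂ C₂ m)
    (hM₂t : ∀ (κ : Fin (d + 1)) (u : Site (d + 1)) (ρ : Fin (d + 1)) (w t : Site (d + 1)),
      M₂ κ (u + (N : ℤ) • t) ρ (w + t) = shiftK (-((N : ℤ) • t)) (M₂ κ u ρ w))
    (h₁ : ∀ y, |ρ₁ y| ≤ 1) (h₂ : ∀ w, |ρ₂ w| ≤ 1)
    (hρ₁ : ∀ y s : Site (d + 1), ρ₁ (y + (N : ℤ) • s) = ρ₁ y) (hρ₂ : ∀ w s : Site (d + 1), ρ₂ (w + (N : ℤ) • s) = ρ₂ w)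
    (κ : Fin (d + 1)) (u : Site (d + 1)) (κ' : Fin (d + 1)) (f g : Fib d) :
    HasSum (fun u' : Site (d + 1) => ∑' yw : Site (d + 1) × Site (d + 1), ρ₁ yw.1 * ρ₂ yw.2 * mixOfK K N M₂ κ' u' κ u yw.1 yw.2 f g) 0 :=
  hasSum_firstBond_of_secondBond (G := fun v w => ∑' yw : Site (d + 1) × Site (d + 1), ρ₁ yw.1 * ρ₂ yw.2 * mixOfK K N M₂ κ' v κ w yw.1 yw.2 f g)
    (fun v w t => twoFace_mixOfK_translate hKs hM₂t hρ₁ hρ₂ κ' v κ w t f g) 0 u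
    (hasSum_twoFace_mixOfK_bond hK hm hK0 hM₂ h₁ h₂ κ' 0 κ f g)

/-- [folklore] **THE FACE-WEIGHTED `W`-WORD, SUMMED ALONG THE BOND, IS HALF THE SUM OF THE TWO SECOND-RESPONSE WORDS.**  For `K` with `Decays K C m` (`m > 0`), block
covariance and zero `colM` bond masses, first tables `S` (`LocStencil`) and `M` (`VertexFamily`) and a jointly block-covariant `LocStencilFM` mixed table `M₂` (all at rate
`m`), bounded `N`-periodic weights: at every first bond `(κ, u)` and fibre pair,
`HasSum (u′ ↦ FFρ[W2SymOfK K N S M 0 M₂ κ u κ′ u′] − ½·(FFρ[dM (K2OfK K N S M κ′ u′) N S M κ u] + FFρ[dM (K2OfK K N S M κ u) N S M κ′ u′])) 0`. -/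
theorem hasSum_twoFace_W2SymOfK_sub_resp (hK : Decays K C m) (hm : 0 < m) (hKs : ∀ t, shiftK (-((N : ℤ) • t)) K = K)
    (hK0 : ∀ μ ρ w, HasSum (fun y : Site (d + 1) => colM K N μ y ρ w) 0)
    (hS : LocStencil S Cs m) (hM : VertexFamily M N CM m) (hM₂ : LocStencilFM N M₂ C₂ m)
    (hM₂t : ∀ (κ : Fin (d + 1)) (u : Site (d + 1)) (ρ : Fin (d + 1)) (w t : Site (d + 1)),
      M₂ κ (u + (N : ℤ) • t) ρ (w + t) = shiftK (-((N : ℤ) • t)) (M₂ κ u ρ w))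
    (h₁ : ∀ y, |ρ₁ y| ≤ 1) (h₂ : ∀ w, |ρ₂ w| ≤ 1)
    (hρ₁ : ∀ y s : Site (d + 1), ρ₁ (y + (N : ℤ) • s) = ρ₁ y) (hρ₂ : ∀ w s : Site (d + 1), ρ₂ (w + (N : ℤ) • s) = ρ₂ w)
    (κ : Fin (d + 1)) (u : Site (d + 1)) (κ' : Fin (d + 1)) (f g : Fib d) :
    HasSum (fun u' : Site (d + 1) =>
      (∑' yw : Site (d + 1) × Site (d + 1), ρ₁ yw.1 * ρ₂ yw.2 * W2SymOfK K N S M 0 M₂ κ u κ' u' yw.1 yw.2 f g)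
        - (1 / 2 : ℝ) * ((∑' yw : Site (d + 1) × Site (d + 1), ρ₁ yw.1 * ρ₂ yw.2 * dM (K2OfK K N S M κ' u') N S M κ u yw.1 yw.2 f g)
          + ∑' yw : Site (d + 1) × Site (d + 1), ρ₁ yw.1 * ρ₂ yw.2 * dM (K2OfK K N S M κ u) N S M κ' u' yw.1 yw.2 f g)) 0 := by
  have hC : 0 ≤ C := hK.nonneg (Sum.inl 0)
  have hCs : 0 ≤ Cs := (hS 0 0).nonneg (Sum.inl 0)
  have hCM : 0 ≤ CM := (hM 0 0).nonneg (Sum.inl 0)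
  have hm8 : 0 < m / 8 := by positivity
  have hm82 : 0 < m / 8 / 2 := by positivity
  -- localisation of the pieces
  have hmix := vertexFamily₂_mixOfK (N := N) hK hC hM₂ hm
  have hK2 := vertexFamily_K2OfK (N := N) hK hC hm hS hM
  have hS8 : LocStencil S Cs (m / 8) := locStencil_mono hS hCs (by linarith)
  have hM8 : VertexFamily M N CM (m / 8) := fun μ y => biLoc_mono (hM μ y) hCM (by linarith)
  have hresp := vertexFamily₂_resp hK2 hS8 hM8 hm8
  -- summability of the weighted pieces over the two legs, at any bond pair
  have s_mix : ∀ (μ : Fin (d + 1)) (y : Site (d + 1)) (ν : Fin (d + 1)) (y' : Site (d + 1)),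
      Summable fun yw : Site (d + 1) × Site (d + 1) => ρ₁ yw.1 * ρ₂ yw.2 * mixOfK K N M₂ μ y ν y' yw.1 yw.2 f g :=
    fun μ y ν y' => summable_twoFace_of_biLoc (hmix μ y ν y') hm8 h₁ h₂ f g
  have s_resp : ∀ (μ : Fin (d + 1)) (y : Site (d + 1)) (ν : Fin (d + 1)) (y' : Site (d + 1)),
      Summable fun yw : Site (d + 1) × Site (d + 1) => ρ₁ yw.1 * ρ₂ yw.2 * dM (K2OfK K N S M ν y') N S M μ y yw.1 yw.2 f g :=
    fun μ y ν y' => summable_twoFace_of_biLoc (hresp μ y ν y') hm82 h₁ h₂ f g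
  -- the bi-vertex of the zero table vanishes
  have hv2 : ∀ (μ : Fin (d + 1)) (y : Site (d + 1)) (ν : Fin (d + 1)) (y' : Site (d + 1)) (x z : Site (d + 1)),
      vertex2OfK K N (0 : Fin (d + 1) → Site (d + 1) → Fin (d + 1) → Site (d + 1) → MKer (d + 1) (Fib d)) μ y ν y' x z f g = 0 := by
    intro μ y ν y' x z
    rw [vertex2OfK_zero K N μ y ν y']
    rfl
  -- the pointwise split of `W2OfK … 0 M₂`
  have e₀ : ∀ (μ : Fin (d + 1)) (y : Site (d + 1)) (ν : Fin (d + 1)) (y' : Site (d + 1)) (yw : Site (d + 1) × Site (d + 1)),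
      ρ₁ yw.1 * ρ₂ yw.2 * W2OfK K N S M 0 M₂ μ y ν y' yw.1 yw.2 f g
        = (ρ₁ yw.1 * ρ₂ yw.2 * mixOfK K N M₂ μ y ν y' yw.1 yw.2 f g + ρ₁ yw.1 * ρ₂ yw.2 * mixOfK K N M₂ ν y' μ y yw.1 yw.2 f g)
          + ρ₁ yw.1 * ρ₂ yw.2 * dM (K2OfK K N S M ν y') N S M μ y yw.1 yw.2 f g := by
    intro μ y ν y' yw
    rw [W2OfK_apply]
    simp only [Pi.add_apply]
    rw [hv2, zero_add]
    ring
  -- the weighted double-leg sum of `W2OfK … 0 M₂` at any bond pair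
  have hW : ∀ (μ : Fin (d + 1)) (y : Site (d + 1)) (ν : Fin (d + 1)) (y' : Site (d + 1)),
      (∑' yw : Site (d + 1) × Site (d + 1), ρ₁ yw.1 * ρ₂ yw.2 * W2OfK K N S M 0 M₂ μ y ν y' yw.1 yw.2 f g)
        = (∑' yw : Site (d + 1) × Site (d + 1), ρ₁ yw.1 * ρ₂ yw.2 * mixOfK K N M₂ μ y ν y' yw.1 yw.2 f g)
          + (∑' yw : Site (d + 1) × Site (d + 1), ρ₁ yw.1 * ρ₂ yw.2 * mixOfK K N M₂ ν y' μ y yw.1 yw.2 f g)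
          + ∑' yw : Site (d + 1) × Site (d + 1), ρ₁ yw.1 * ρ₂ yw.2 * dM (K2OfK K N S M ν y') N S M μ y yw.1 yw.2 f g := by
    intro μ y ν y'
    rw [tsum_congr (e₀ μ y ν y'), ((s_mix μ y ν y').add (s_mix ν y' μ y)).tsum_add (s_resp μ y ν y'),
      (s_mix μ y ν y').tsum_add (s_mix ν y' μ y)]
  have sW : ∀ (μ : Fin (d + 1)) (y : Site (d + 1)) (ν : Fin (d + 1)) (y' : Site (d + 1)),
      Summable fun yw : Site (d + 1) × Site (d + 1) => ρ₁ yw.1 * ρ₂ yw.2 * W2OfK K N S M 0 M₂ μ y ν y' yw.1 yw.2 f g :=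
    fun μ y ν y' => (((s_mix μ y ν y').add (s_mix ν y' μ y)).add (s_resp μ y ν y')).congr fun yw => (e₀ μ y ν y' yw).symm
  -- the weighted double-leg sum of `W2SymOfK … 0 M₂`
  have hSym : ∀ u' : Site (d + 1),
      (∑' yw : Site (d + 1) × Site (d + 1), ρ₁ yw.1 * ρ₂ yw.2 * W2SymOfK K N S M 0 M₂ κ u κ' u' yw.1 yw.2 f g)
        - (1 / 2 : ℝ) * ((∑' yw : Site (d + 1) × Site (d + 1), ρ₁ yw.1 * ρ₂ yw.2 * dM (K2OfK K N S M κ' u') N S M κ u yw.1 yw.2 f g)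
          + ∑' yw : Site (d + 1) × Site (d + 1), ρ₁ yw.1 * ρ₂ yw.2 * dM (K2OfK K N S M κ u) N S M κ' u' yw.1 yw.2 f g)
        = (∑' yw : Site (d + 1) × Site (d + 1), ρ₁ yw.1 * ρ₂ yw.2 * mixOfK K N M₂ κ u κ' u' yw.1 yw.2 f g)
          + ∑' yw : Site (d + 1) × Site (d + 1), ρ₁ yw.1 * ρ₂ yw.2 * mixOfK K N M₂ κ' u' κ u yw.1 yw.2 f g := by
    intro u'
    have e : ∀ yw : Site (d + 1) × Site (d + 1), ρ₁ yw.1 * ρ₂ yw.2 * W2SymOfK K N S M 0 M₂ κ u κ' u' yw.1 yw.2 f g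
        = (1 / 2 : ℝ) * (ρ₁ yw.1 * ρ₂ yw.2 * W2OfK K N S M 0 M₂ κ u κ' u' yw.1 yw.2 f g
          + ρ₁ yw.1 * ρ₂ yw.2 * W2OfK K N S M 0 M₂ κ' u' κ u yw.1 yw.2 f g) := by
      intro yw
      simp only [W2SymOfK, Pi.smul_apply, Pi.add_apply, smul_eq_mul]
      ring
    rw [tsum_congr e, tsum_mul_left, (sW κ u κ' u').tsum_add (sW κ' u' κ u), hW κ u κ' u', hW κ' u' κ u]
    ring
  simp_rw [hSym]
  have h := (hasSum_twoFace_mixOfK_bond hK hm hK0 hM₂ h₁ h₂ κ u κ' f g).add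
    (hasSum_twoFace_mixOfK_swap_bond hK hm hKs hK0 hM₂ hM₂t h₁ h₂ hρ₁ hρ₂ κ u κ' f g)
  rwa [add_zero] at h

/-- [folklore] **`tsum` FORM**: when the two second-response words are summable along the bond, `Σ'_{u′} FFρ[W2SymOfK K N S M 0 M₂ κ u κ′ u′]
= ½·(Σ'_{u′} FFρ[dM (K2OfK … κ′ u′) N S M κ u] + Σ'_{u′} FFρ[dM (K2OfK … κ u) N S M κ′ u′])`. -/
theorem tsum_twoFace_W2SymOfK_eq_half_resp (hK : Decays K C m) (hm : 0 < m) (hKs : ∀ t, shiftK (-((N : ℤ) • t)) K = K)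
    (hK0 : ∀ μ ρ w, HasSum (fun y : Site (d + 1) => colM K N μ y ρ w) 0)
    (hS : LocStencil S Cs m) (hM : VertexFamily M N CM m) (hM₂ : LocStencilFM N M₂ C₂ m)
    (hM₂t : ∀ (κ : Fin (d + 1)) (u : Site (d + 1)) (ρ : Fin (d + 1)) (w t : Site (d + 1)),
      M₂ κ (u + (N : ℤ) • t) ρ (w + t) = shiftK (-((N : ℤ) • t)) (M₂ κ u ρ w))
    (h₁ : ∀ y, |ρ₁ y| ≤ 1) (h₂ : ∀ w, |ρ₂ w| ≤ 1)
    (hρ₁ : ∀ y s : Site (d + 1), ρ₁ (y + (N : ℤ) • s) = ρ₁ y) (hρ₂ : ∀ w s : Site (d + 1), ρ₂ (w + (N : ℤ) • s) = ρ₂ w)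
    (κ : Fin (d + 1)) (u : Site (d + 1)) (κ' : Fin (d + 1)) (f g : Fib d)
    (hR₁ : Summable fun u' : Site (d + 1) =>
      ∑' yw : Site (d + 1) × Site (d + 1), ρ₁ yw.1 * ρ₂ yw.2 * dM (K2OfK K N S M κ' u') N S M κ u yw.1 yw.2 f g)
    (hR₂ : Summable fun u' : Site (d + 1) =>
      ∑' yw : Site (d + 1) × Site (d + 1), ρ₁ yw.1 * ρ₂ yw.2 * dM (K2OfK K N S M κ u) N S M κ' u' yw.1 yw.2 f g) :
    (∑' u' : Site (d + 1), ∑' yw : Site (d + 1) × Site (d + 1), ρ₁ yw.1 * ρ₂ yw.2 * W2SymOfK K N S M 0 M₂ κ u κ' u' yw.1 yw.2 f g)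
      = (1 / 2 : ℝ) * ((∑' u' : Site (d + 1), ∑' yw : Site (d + 1) × Site (d + 1), ρ₁ yw.1 * ρ₂ yw.2 * dM (K2OfK K N S M κ' u') N S M κ u yw.1 yw.2 f g)
        + ∑' u' : Site (d + 1), ∑' yw : Site (d + 1) × Site (d + 1), ρ₁ yw.1 * ρ₂ yw.2 * dM (K2OfK K N S M κ u) N S M κ' u' yw.1 yw.2 f g) := by
  have h0 := hasSum_twoFace_W2SymOfK_sub_resp hK hm hKs hK0 hS hM hM₂ hM₂t h₁ h₂ hρ₁ hρ₂ κ u κ' f g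
  have hR : Summable fun u' : Site (d + 1) =>
      (1 / 2 : ℝ) * ((∑' yw : Site (d + 1) × Site (d + 1), ρ₁ yw.1 * ρ₂ yw.2 * dM (K2OfK K N S M κ' u') N S M κ u yw.1 yw.2 f g)
        + ∑' yw : Site (d + 1) × Site (d + 1), ρ₁ yw.1 * ρ₂ yw.2 * dM (K2OfK K N S M κ u) N S M κ' u' yw.1 yw.2 f g) :=
    (hR₁.add hR₂).mul_left (1 / 2 : ℝ)
  have h := h0.add hR.hasSum
  simp only [sub_add_cancel, zero_add] at h
  rw [h.tsum_eq, tsum_mul_left, hR₁.tsum_add hR₂]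

end Generic


/-! ## §2 The dressed instances: `X̃♮_j = unitK s_f s_m (coDressKBmAt ρ Lc (KInvStep Lc j))` at an in-block root -/

section Dressed

variable {Lc : ℕ} [NeZero Lc] {r : Fin (d + 1) → ℕ} {ρ₁ ρ₂ : Site (d + 1) → ℝ}
  {M₂ : Fin (d + 1) → Site (d + 1) → Fin (d + 1) → Site (d + 1) → MKer (d + 1) (Fib d)} {C₂ δ₂ : ℝ}
  {S M : Fin (d + 1) → Site (d + 1) → MKer (d + 1) (Fib d)} {Cs δs CM δM : ℝ}

/-- [folklore] **(S2c) FOR THE DRESSED KERNEL ⟹ THE FACE-WEIGHTED PAIR SUMS OF `mixOfK X̃♮_j Lc M₂ κ u κ′ u′` HAVE ZERO BOND SUM IN `u′`** (in-block root, `1 ≤ Lc`,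
every `j`, all units, every `LocStencilFM Lc M₂ C₂ δ₂` with `δ₂ > 0`, bounded weights, every first bond and fibre pair). -/
theorem hasSum_twoFace_mixOfK_dressedStep_bond (hLc : 1 ≤ Lc) (hr : r ∈ box (d + 1) Lc) (sf sm : ℝ) (j : ℕ)
    (hM₂ : LocStencilFM Lc M₂ C₂ δ₂) (hδ₂ : 0 < δ₂) (h₁ : ∀ y, |ρ₁ y| ≤ 1) (h₂ : ∀ w, |ρ₂ w| ≤ 1)
    (κ : Fin (d + 1)) (u : Site (d + 1)) (κ' : Fin (d + 1)) (f g : Fib d) :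
    HasSum (fun u' : Site (d + 1) => ∑' yw : Site (d + 1) × Site (d + 1), ρ₁ yw.1 * ρ₂ yw.2 *
      mixOfK (unitK sf sm (coDressKBmAt (toSite r) Lc (KInvStep (d := d) Lc j))) Lc M₂ κ u κ' u' yw.1 yw.2 f g) 0 := by
  obtain ⟨δ, C, hδ, hC, hXd⟩ := decays_coDressKBmAt hLc hr (decays_KInvStep (d := d) (Lc := Lc) j)
  have hXu := decays_unitK (sf := sf) (sm := sm) hXd
  have hm : 0 < min δ δ₂ := lt_min hδ hδ₂
  have hXu' : Decays (unitK sf sm (coDressKBmAt (toSite r) Lc (KInvStep (d := d) Lc j))) (max |sf| |sm| * C * max |sf| |sm|) (min δ δ₂) :=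
    decays_mono hXu (by positivity) le_rfl (min_le_left _ _)
  exact hasSum_twoFace_mixOfK_bond hXu' hm (fun μ ρ' w => hasSum_colM_dressedStep (toSite r) sf sm j μ ρ' w) (hM₂.mono (min_le_right _ _))
    h₁ h₂ κ u κ' f g

/-- [folklore] **… AND OF THE EXCHANGED MIXED BI-VERTEX `mixOfK X̃♮_j Lc M₂ κ′ u′ κ u`** (jointly block-covariant `M₂`, `Lc`-periodic weights; block covariance of the
dressed kernel is `EEWordReduced.shiftK_dressedStep`). -/
theorem hasSum_twoFace_mixOfK_swap_dressedStep_bond (hLc : 1 ≤ Lc) (hr : r ∈ box (d + 1) Lc) (sf sm : ℝ) (j : ℕ)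
    (hM₂ : LocStencilFM Lc M₂ C₂ δ₂) (hδ₂ : 0 < δ₂)
    (hM₂t : ∀ (κ : Fin (d + 1)) (u : Site (d + 1)) (ρ : Fin (d + 1)) (w t : Site (d + 1)),
      M₂ κ (u + (Lc : ℤ) • t) ρ (w + t) = shiftK (-((Lc : ℤ) • t)) (M₂ κ u ρ w))
    (h₁ : ∀ y, |ρ₁ y| ≤ 1) (h₂ : ∀ w, |ρ₂ w| ≤ 1)
    (hρ₁ : ∀ y s : Site (d + 1), ρ₁ (y + (Lc : ℤ) • s) = ρ₁ y) (hρ₂ : ∀ w s : Site (d + 1), ρ₂ (w + (Lc : ℤ) • s) = ρ₂ w)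
    (κ : Fin (d + 1)) (u : Site (d + 1)) (κ' : Fin (d + 1)) (f g : Fib d) :
    HasSum (fun u' : Site (d + 1) => ∑' yw : Site (d + 1) × Site (d + 1), ρ₁ yw.1 * ρ₂ yw.2 *
      mixOfK (unitK sf sm (coDressKBmAt (toSite r) Lc (KInvStep (d := d) Lc j))) Lc M₂ κ' u' κ u yw.1 yw.2 f g) 0 := by
  obtain ⟨δ, C, hδ, hC, hXd⟩ := decays_coDressKBmAt hLc hr (decays_KInvStep (d := d) (Lc := Lc) j)
  have hXu := decays_unitK (sf := sf) (sm := sm) hXd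
  have hm : 0 < min δ δ₂ := lt_min hδ hδ₂
  have hXu' : Decays (unitK sf sm (coDressKBmAt (toSite r) Lc (KInvStep (d := d) Lc j))) (max |sf| |sm| * C * max |sf| |sm|) (min δ δ₂) :=
    decays_mono hXu (by positivity) le_rfl (min_le_left _ _)
  exact hasSum_twoFace_mixOfK_swap_bond hXu' hm (fun t => shiftK_dressedStep (r := r) hLc sf sm j t)
    (fun μ ρ' w => hasSum_colM_dressedStep (toSite r) sf sm j μ ρ' w) (hM₂.mono (min_le_right _ _)) hM₂t h₁ h₂ hρ₁ hρ₂ κ u κ' f g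

/-- [folklore] **THE FACE-WEIGHTED `W`-WORD OF THE DRESSED SOURCE, SUMMED ALONG THE LATTICE BOND, IS HALF THE SUM OF ITS TWO SECOND-RESPONSE WORDS** (in-block root,
`1 ≤ Lc`, every `j`, all units; ANY `LocStencil` first field table `S` (e.g. `unitS s_f s_m (SpureRecAt d Lc ρ cE cVH cΛ j)`), ANY `VertexFamily` `M`, ANY jointly block-covariant
`LocStencilFM` `M₂` (e.g. the units-dressed `M2Of` table of p2's source), positive rates; bounded `Lc`-periodic weights (e.g. the exit-face indicators of
`DressedSourceZeroModeWords`); every first bond `(κ, u)` and fibre pair):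
`HasSum (u′ ↦ FFρ[W2SymOfK X̃♮_j Lc S M 0 M₂ κ u κ′ u′] − ½·(FFρ[dM (K2OfK X̃♮_j Lc S M κ′ u′) Lc S M κ u] + FFρ[dM (K2OfK X̃♮_j Lc S M κ u) Lc S M κ′ u′])) 0`. -/
theorem hasSum_twoFace_W2SymOfK_sub_resp_dressedStep (hLc : 1 ≤ Lc) (hr : r ∈ box (d + 1) Lc) (sf sm : ℝ) (j : ℕ)
    (hS : LocStencil S Cs δs) (hδs : 0 < δs) (hM : VertexFamily M Lc CM δM) (hδM : 0 < δM) (hM₂ : LocStencilFM Lc M₂ C₂ δ₂) (hδ₂ : 0 < δ₂)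
    (hM₂t : ∀ (κ : Fin (d + 1)) (u : Site (d + 1)) (ρ : Fin (d + 1)) (w t : Site (d + 1)),
      M₂ κ (u + (Lc : ℤ) • t) ρ (w + t) = shiftK (-((Lc : ℤ) • t)) (M₂ κ u ρ w))
    (h₁ : ∀ y, |ρ₁ y| ≤ 1) (h₂ : ∀ w, |ρ₂ w| ≤ 1)
    (hρ₁ : ∀ y s : Site (d + 1), ρ₁ (y + (Lc : ℤ) • s) = ρ₁ y) (hρ₂ : ∀ w s : Site (d + 1), ρ₂ (w + (Lc : ℤ) • s) = ρ₂ w)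
    (κ : Fin (d + 1)) (u : Site (d + 1)) (κ' : Fin (d + 1)) (f g : Fib d) :
    HasSum (fun u' : Site (d + 1) =>
      (∑' yw : Site (d + 1) × Site (d + 1), ρ₁ yw.1 * ρ₂ yw.2 *
          W2SymOfK (unitK sf sm (coDressKBmAt (toSite r) Lc (KInvStep (d := d) Lc j))) Lc S M 0 M₂ κ u κ' u' yw.1 yw.2 f g)
        - (1 / 2 : ℝ) * ((∑' yw : Site (d + 1) × Site (d + 1), ρ₁ yw.1 * ρ₂ yw.2 *
            dM (K2OfK (unitK sf sm (coDressKBmAt (toSite r) Lc (KInvStep (d := d) Lc j))) Lc S M κ' u') Lc S M κ u yw.1 yw.2 f g)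
          + ∑' yw : Site (d + 1) × Site (d + 1), ρ₁ yw.1 * ρ₂ yw.2 *
            dM (K2OfK (unitK sf sm (coDressKBmAt (toSite r) Lc (KInvStep (d := d) Lc j))) Lc S M κ u) Lc S M κ' u' yw.1 yw.2 f g)) 0 := by
  obtain ⟨δ, C, hδ, hC, hXd⟩ := decays_coDressKBmAt hLc hr (decays_KInvStep (d := d) (Lc := Lc) j)
  have hXu := decays_unitK (sf := sf) (sm := sm) hXd
  have hCs : 0 ≤ Cs := (hS 0 0).nonneg (Sum.inl 0)
  have hCM : 0 ≤ CM := (hM 0 0).nonneg (Sum.inl 0)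
  set m : ℝ := min (min (min δ δs) δM) δ₂ with hm_def
  have hm : 0 < m := lt_min (lt_min (lt_min hδ hδs) hδM) hδ₂
  have hm2 : m ≤ δ₂ := min_le_right _ _
  have hmM : m ≤ δM := (min_le_left _ _).trans (min_le_right _ _)
  have hms : m ≤ δs := (min_le_left _ _).trans ((min_le_left _ _).trans (min_le_right _ _))
  have hmK : m ≤ δ := (min_le_left _ _).trans ((min_le_left _ _).trans (min_le_left _ _))
  have hXu' : Decays (unitK sf sm (coDressKBmAt (toSite r) Lc (KInvStep (d := d) Lc j))) (max |sf| |sm| * C * max |sf| |sm|) m :=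
    decays_mono hXu (by positivity) le_rfl hmK
  exact hasSum_twoFace_W2SymOfK_sub_resp hXu' hm (fun t => shiftK_dressedStep (r := r) hLc sf sm j t)
    (fun μ ρ' w => hasSum_colM_dressedStep (toSite r) sf sm j μ ρ' w)
    (locStencil_mono hS hCs hms) (fun μ y => biLoc_mono (hM μ y) hCM hmM) (hM₂.mono hm2) hM₂t h₁ h₂ hρ₁ hρ₂ κ u κ' f g

/-- [folklore] **`tsum` FORM FOR THE DRESSED SOURCE**: when the two second-response words are summable along the bond,
`Σ'_{u′} FFρ[W̃♮_j κ u κ′ u′] = ½·(Σ'_{u′} FFρ[dM (K2OfK X̃♮_j Lc S M κ′ u′) Lc S M κ u] + Σ'_{u′} FFρ[dM (K2OfK X̃♮_j Lc S M κ u) Lc S M κ′ u′])` — the mixed table `M₂` is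
gone from the `K·W·K` word of `DressedSourceZeroModeWords.zmode_dressedSource_inl_inl_of_summable`. -/
theorem tsum_twoFace_W2SymOfK_dressedStep_eq_half_resp (hLc : 1 ≤ Lc) (hr : r ∈ box (d + 1) Lc) (sf sm : ℝ) (j : ℕ)
    (hS : LocStencil S Cs δs) (hδs : 0 < δs) (hM : VertexFamily M Lc CM δM) (hδM : 0 < δM) (hM₂ : LocStencilFM Lc M₂ C₂ δ₂) (hδ₂ : 0 < δ₂)
    (hM₂t : ∀ (κ : Fin (d + 1)) (u : Site (d + 1)) (ρ : Fin (d + 1)) (w t : Site (d + 1)),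
      M₂ κ (u + (Lc : ℤ) • t) ρ (w + t) = shiftK (-((Lc : ℤ) • t)) (M₂ κ u ρ w))
    (h₁ : ∀ y, |ρ₁ y| ≤ 1) (h₂ : ∀ w, |ρ₂ w| ≤ 1)
    (hρ₁ : ∀ y s : Site (d + 1), ρ₁ (y + (Lc : ℤ) • s) = ρ₁ y) (hρ₂ : ∀ w s : Site (d + 1), ρ₂ (w + (Lc : ℤ) • s) = ρ₂ w)
    (κ : Fin (d + 1)) (u : Site (d + 1)) (κ' : Fin (d + 1)) (f g : Fib d)
    (hR₁ : Summable fun u' : Site (d + 1) => ∑' yw : Site (d + 1) × Site (d + 1), ρ₁ yw.1 * ρ₂ yw.2 *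
      dM (K2OfK (unitK sf sm (coDressKBmAt (toSite r) Lc (KInvStep (d := d) Lc j))) Lc S M κ' u') Lc S M κ u yw.1 yw.2 f g)
    (hR₂ : Summable fun u' : Site (d + 1) => ∑' yw : Site (d + 1) × Site (d + 1), ρ₁ yw.1 * ρ₂ yw.2 *
      dM (K2OfK (unitK sf sm (coDressKBmAt (toSite r) Lc (KInvStep (d := d) Lc j))) Lc S M κ u) Lc S M κ' u' yw.1 yw.2 f g) :
    (∑' u' : Site (d + 1), ∑' yw : Site (d + 1) × Site (d + 1), ρ₁ yw.1 * ρ₂ yw.2 *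
        W2SymOfK (unitK sf sm (coDressKBmAt (toSite r) Lc (KInvStep (d := d) Lc j))) Lc S M 0 M₂ κ u κ' u' yw.1 yw.2 f g)
      = (1 / 2 : ℝ) * ((∑' u' : Site (d + 1), ∑' yw : Site (d + 1) × Site (d + 1), ρ₁ yw.1 * ρ₂ yw.2 *
            dM (K2OfK (unitK sf sm (coDressKBmAt (toSite r) Lc (KInvStep (d := d) Lc j))) Lc S M κ' u') Lc S M κ u yw.1 yw.2 f g)
        + ∑' u' : Site (d + 1), ∑' yw : Site (d + 1) × Site (d + 1), ρ₁ yw.1 * ρ₂ yw.2 *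
            dM (K2OfK (unitK sf sm (coDressKBmAt (toSite r) Lc (KInvStep (d := d) Lc j))) Lc S M κ u) Lc S M κ' u' yw.1 yw.2 f g) := by
  have h0 := hasSum_twoFace_W2SymOfK_sub_resp_dressedStep hLc hr sf sm j hS hδs hM hδM hM₂ hδ₂ hM₂t h₁ h₂ hρ₁ hρ₂ κ u κ' f g
  have hR : Summable fun u' : Site (d + 1) =>
      (1 / 2 : ℝ) * ((∑' yw : Site (d + 1) × Site (d + 1), ρ₁ yw.1 * ρ₂ yw.2 *
          dM (K2OfK (unitK sf sm (coDressKBmAt (toSite r) Lc (KInvStep (d := d) Lc j))) Lc S M κ' u') Lc S M κ u yw.1 yw.2 f g)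
        + ∑' yw : Site (d + 1) × Site (d + 1), ρ₁ yw.1 * ρ₂ yw.2 *
          dM (K2OfK (unitK sf sm (coDressKBmAt (toSite r) Lc (KInvStep (d := d) Lc j))) Lc S M κ u) Lc S M κ' u' yw.1 yw.2 f g) :=
    (hR₁.add hR₂).mul_left (1 / 2 : ℝ)
  have h := h0.add hR.hasSum
  simp only [sub_add_cancel, zero_add] at h
  rw [h.tsum_eq, tsum_mul_left, hR₁.tsum_add hR₂]

end Dressed

end Summit.QuantumFields.BalabanUV.Beta.GAN24.WWordMixedBondZero

end
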